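import Mathlib
import HarnessLib
import Summits.HubbardSuperconductivity.HubbardSuperconductivity.Theses.KLProgramme
import Summits.HubbardSuperconductivity.HubbardSuperconductivity.Theorems.KLProgrammeKLRegimeBetaSplitV17F2

/-!
# Route `KLProgramme` — crux K3 gen 8 (rev 22), child 1 `KLRegimeBetaSplitV17F2 := BetaSplitP klPredsV17F2 klWindowC` (stmt-HubbardSuperconductivity-20438),
# CLOSED by `KLRegimeSplit.betaSplitP_klPredsV17F2` (`…BetaSplitV17F2`, k3c1-p1 g8, the child-1 flow port of k3c1-p2's CHILD1-FLOW-PORT recipe).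
# Proof only; nothing here asserts superconductivity.
-/

noncomputable section

namespace Summit.HubbardSuperconductivity.HubbardSuperconductivity.Theorems

set_option linter.dupNamespace false -- summit = problem name (single-conjunct summit), D-0017

/-- **Child 1 of the gen-8 split of K3 (flowing-dispersion scheme F-II, cured bundle), by name**: `KLRegimeBetaSplitV17F2`. -/
theorem klRegimeBetaSplitV17F2_proof : Summit.HubbardSuperconductivity.HubbardSuperconductivity.Theses.KLProgramme.KLRegimeBetaSplitV17F2 :=
  KLRegimeSplit.betaSplitP_klPredsV17F2 KLRegimeSplit.klWindowC

end Summit.HubbardSuperconductivity.HubbardSuperconductivity.Theorems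

end
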